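/-
Copyright (c) 2026. All rights reserved.
Released under Apache 2.0 license as described in the file LICENSE.
Authors: abc-iut cell, seat abc-iut-w5-d226 (gen 3; NON-VACUITY of the constructed DPSC-extension chain).
-/
import Literature.AnabelianGeometry.AbsoluteAnabelian.AbsTopII.DPSCDataOfOuterAction
import Literature.AnabelianGeometry.AbsoluteAnabelian.AbsTopII.DPSCDataOfOuterActionInertia
import Literature.AnabelianGeometry.SemiGraphs.ProSigmaCompletionModels
import Literature.AnabelianGeometry.SemiGraphs.ProSigmaCompletionTFG
import Literature.AnabelianGeometry.SemiGraphs.ProSigmaClosedSurfaceSlimCore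
import Literature.AnabelianGeometry.SemiGraphs.PSCRamificationProofs
import HarnessLib

/-!
# [AbsTopII] Prop 1.3 (vi), (vii) UNCONDITIONALLY at a constructed DPSC-extension (non-vacuity)

S. Mochizuki, *Topics in Absolute Anabelian Geometry II* [AbsTopII] (bib `MochizukiAbsTopII2013`), §1
Def 1.2 (ii) p. 10, Prop 1.3 (vi) (vii) p. 12; [CombGC] (bib `MochizukiCombGC2007`) Def 1.1, Prop 1.2;
[AbsAnab] Lemma 1.3.1 (slimness of pro-`Σ` surface groups; tree: `proSigmaSurfaceGroupSlim_holds`).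

PROOF-ONLY non-vacuity certificate (no definitions) for the chain
`DPSCData.ofOuterAction → prop13vi/vii_ofOuterAction(_of_lifts)` (`AbsTopII/DPSCDataOfOuterAction.lean`):
at a GENUINE profinite group — a pro-`Σ` completion `Π` of the surface group of genus `2` (the shape of the
geometric pro-`Σ` fundamental group of a smooth proper curve of genus `2`; `Σ` any nonempty set of
primes), topologically finitely generated (`isTopologicallyFinitelyGenerated_of_puncturedSurfaceGroup`)
and centre-free (slim: `proSigmaSurfaceGroupSlim_holds`) — with the ONE-VERTEX PSC datum of smooth proper
shape (`Π_v = Π`, no nodes, no cusps, genus `2`) and the TRIVIAL continuous outer action of the profinite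
group `J := Π` (inertia `I := J`), ALL hypotheses of `prop13vi_ofOuterAction_of_lifts` and
`prop13vii_ofOuterAction` are PROVED: the graphic lift of every outer class is the identity, [CombGC]
Prop 1.2 (ii) holds because the only verticial subgroup is `Π` itself and there are no edge-like ones,
Prop 1.2 (i) because there is one vertex and no edge, and the Prop 1.3 (ii) clauses are vacuous (no
nodes).  Hence the typed [AbsTopII] Prop 1.3 (vi) (F-0279) and (vii) (F-0280) hold with NO hypothesis at
this constructed `DPSCData` — the conditional theorems are not vacuous and the kernel chain composes.

HONEST SCOPE: a smooth proper one-component special fibre with trivial outer Galois action is the most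
degenerate PRINTED configuration (X smooth over k, `H` acting trivially); it exercises the construction
and the [CombGC] inputs, not the nodal/cuspidal combinatorics.  Nothing here bears on [IUTchIII] Cor 3.12.
-/

noncomputable section

open scoped Pointwise

namespace Literature.AnabelianGeometry.AbsoluteAnabelian

open Literature.AlgebraicGeometry.Frobenioids (IsSlimGroup)
open Literature.AnabelianGeometry.EtaleTheta (contMulAut mem_contMulAut TopOut)
open Literature.AnabelianGeometry.SemiGraphs
open Literature.AnabelianGeometry.SemiGraphs.SemiGraphOfAnabelioids (IsProSigmaCompletion)
open Literature.GroupTheory.CombinatorialGroupTheory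
open Topology

namespace DPSCData

/-! ### Generic facts used by the witness -/

section Generic

variable {P : Type} [Group P] [TopologicalSpace P]

/-- A pro-`Σ` completion (in the sense of [SemiAnbd] Ex. 2.10) is a pro-`Σ` group in the sense of
[CombGC] Def 1.1 (ii). [cite: MochizukiCombGC2007, Def 1.1(ii) p.6] -/
theorem isProSigma_of_isProSigmaCompletion {Sigma : Set ℕ} {Γ : Type} [Group Γ] {ι : Γ →* P}
    (hι : IsProSigmaCompletion Sigma ι) : IsProSigma Sigma P :=
  ⟨fun U _ p hp hdvd => (hι.index_open U.toSubgroup inferInstance U.isOpen').2 p hp hdvd⟩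

/-- A slim group is centre-free (the whole group is open). [cite: MochizukiCombGC2007, Rmk 1.1.3 p.8] -/
theorem center_eq_bot_of_isSlimGroup' (h : IsSlimGroup P) : Subgroup.center P = ⊥ := by
  rw [eq_bot_iff]
  intro z hz
  have h1 : z ∈ Subgroup.centralizer ((⊤ : Subgroup P) : Set P) := by
    rw [Subgroup.mem_centralizer_iff]
    exact fun g _ => (Subgroup.mem_center_iff.mp hz g)
  have h2 : Subgroup.centralizer ((⊤ : Subgroup P) : Set P) = ⊥ := h.centralizer_eq_bot ⊤ (by simp)
  exact h2.le h1

omit [TopologicalSpace P] in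
/-- The whole group is commensurably terminal in itself. [cite: MochizukiCombGC2007, Prop 1.2(ii) p.8] -/
theorem commensurator_top : Subgroup.Commensurable.commensurator (⊤ : Subgroup P) = ⊤ :=
  top_le_iff.mp fun g _ => by
    rw [Subgroup.Commensurable.commensurator_mem_iff, PSCDatum.conjAct_smul_top]

/-- `⊤ ≃ₜ* P`: the whole group as a topological group. [cite: MochizukiCombGC2007, Rmk 1.1.3 p.8] -/
theorem isSlimGroup_top (h : IsSlimGroup P) : IsSlimGroup ↥(⊤ : Subgroup P) :=
  isSlimGroup_of_continuousMulEquiv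
    ({ (Subgroup.topEquiv : (⊤ : Subgroup P) ≃* P).symm with
      continuous_toFun := continuous_induced_rng.2 continuous_id
      continuous_invFun := continuous_subtype_val } : P ≃ₜ* ↥(⊤ : Subgroup P)) h

end Generic

/-! ### The one-vertex PSC datum of smooth proper shape on a profinite group -/

/-- **[AbsTopII] Prop 1.3 (vi) and (vii) hold UNCONDITIONALLY at a constructed DPSC-extension**
(non-vacuity of `prop13vi_ofOuterAction_of_lifts` / `prop13vii_ofOuterAction`): for every nonempty set
of primes `Σ` there are a profinite group `Π` which is a pro-`Σ` completion of the genus-`2` surface group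
(topologically finitely generated, centre-free), the one-vertex PSC datum `G` of smooth proper shape on
it (`Π_v = Π`, no nodes, no cusps), and — for the trivial continuous outer action `θ = 1` of `J := Π`
with inertia `I := J` — the constructed DPSC data `DPSCData.ofOuterAction G hG 1 ⊤` SATISFIES the typed
Prop 1.3 (vi) (F-0279) and (vii) (F-0280), all hypotheses of the conditional theorems being PROVED here.
[cite: MochizukiAbsTopII2013, Prop 1.3 (vi) p.12] [cite: MochizukiCombGC2007, Prop 1.2 p.8] -/
theorem exists_ofOuterAction_prop13vi_prop13vii (Sigma : Set ℕ) (hS₁ : Sigma.Nonempty)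
    (hS₂ : ∀ p ∈ Sigma, p.Prime) :
    ∃ (Q : ProfiniteGrp.{0}) (ι₀ : PuncturedSurfaceGroup 2 0 →* Q) (_ : IsProSigmaCompletion Sigma ι₀)
      (G : PSCDatum Q) (hG : IsTopologicallyFinitelyGenerated Q),
      Subgroup.center (Q : Type) = ⊥ ∧ (∀ v, G.vertGp v = ⊤) ∧ IsEmpty G.graph.N ∧ IsEmpty G.graph.C ∧
      Nonempty G.graph.V ∧
      (ofOuterAction G hG (1 : Q →ₜ* outProfinite hG) ⊤).Prop13vi ∧
      (ofOuterAction G hG (1 : Q →ₜ* outProfinite hG) ⊤).Prop13vii := by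
  -- the group: a pro-`Σ` completion of the genus-2 surface group
  obtain ⟨Q, ι₀, hι₀⟩ := IsProSigmaCompletion.exists_isProSigmaCompletion (PuncturedSurfaceGroup 2 0) Sigma
  have hG : IsTopologicallyFinitelyGenerated Q :=
    IsProSigmaCompletion.isTopologicallyFinitelyGenerated_of_puncturedSurfaceGroup (MulEquiv.refl _) hι₀
  have hslim : IsSlimGroup Q :=
    proSigmaSurfaceGroupSlim_holds Sigma hS₁ hS₂ 2 0 (by change 2 < 2 * 2 + 0; norm_num) Q ι₀ hι₀
  have hZ : Subgroup.center (Q : Type) = ⊥ := center_eq_bot_of_isSlimGroup' hslim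
  -- the one-vertex PSC datum of smooth proper shape
  let graph : PSCSemiGraph :=
    { V := Unit, N := Empty, C := Empty, nodeEnds := fun e => e.elim, cuspEnd := fun c => c.elim }
  let G : PSCDatum Q :=
    { Sigma := Sigma
      sigma_prime := hS₂
      sigma_nonempty := hS₁
      graph := graph
      vertGp := fun _ => ⊤
      nodeGp := fun e => e.elim
      cuspGp := fun c => c.elim
      genus := fun _ => 2
      isClosed_vertGp := fun _ => by simp
      isClosed_nodeGp := fun e => e.elim
      isClosed_cuspGp := fun c => c.elim
      nodeGp_le := fun e => e.elim
      cuspGp_le := fun c => c.elim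
      proSigma := isProSigma_of_isProSigmaCompletion hι₀ }
  -- [CombGC] Prop 1.2 (ii): the only verticial subgroup is `⊤`, there are no edge-like subgroups
  have hCT : G.VerticialEdgeLikeCommensurablyTerminal := by
    rintro A (⟨v, γ, rfl⟩ | (⟨e, -, -⟩ | ⟨c, -, -⟩))
    · change Subgroup.Commensurable.commensurator (γ • (⊤ : Subgroup Q)) = γ • ⊤
      rw [PSCDatum.conjAct_smul_top, commensurator_top]
    · exact e.elim
    · exact c.elim
  -- [CombGC] Prop 1.2 (i): one vertex, no edges
  have hDetV : G.VerticialOpenInterDeterminesVertex := fun v₁ v₂ _ _ _ => Subsingleton.elim v₁ v₂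
  have hDet : G.EdgeLikeOpenInterDeterminesEdge := by
    rintro (e | c)
    · exact e.elim
    · exact c.elim
  -- the trivial outer action has the identity as a graphic lift of every class
  have hθ : ∀ j : (Q : Type), ∃ φ : (Q : Type) ≃ₜ* (Q : Type),
      TopOut.mk (Q : Type) ⟨φ.toMulEquiv, (mem_contMulAut (Q : Type)).mpr ⟨φ.continuous, φ.symm.continuous⟩⟩ =
        outerActionOfContinuous hG (1 : Q →ₜ* outProfinite hG) j ∧ G.IsGraphic G φ := by
    intro j
    refine ⟨ContinuousMulEquiv.refl _, ?_, PSCDatum.isGraphic_refl G⟩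
    have h1 : outerActionOfContinuous hG (1 : Q →ₜ* outProfinite hG) j = 1 := by
      change (outEquiv hG).symm.toMonoidHom ((1 : Q →ₜ* outProfinite hG) j) = 1
      have h0 : ((1 : Q →ₜ* outProfinite hG) j) = 1 := rfl
      rw [h0, map_one]
    have h2 : ∀ hc : (ContinuousMulEquiv.refl (Q : Type)).toMulEquiv ∈ contMulAut (Q : Type),
        (⟨(ContinuousMulEquiv.refl (Q : Type)).toMulEquiv, hc⟩ : contMulAut (Q : Type)) = 1 :=
      fun _ => Subtype.ext rfl
    rw [h1, h2, map_one]
  refine ⟨Q, ι₀, hι₀, G, hG, hZ, fun _ => rfl, inferInstanceAs (IsEmpty Empty),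
    inferInstanceAs (IsEmpty Empty), ⟨()⟩, ?_, ?_⟩
  · exact prop13vi_ofOuterAction_of_lifts G hG hZ 1 ⊤ hθ hCT hDetV
  · exact prop13vii_ofOuterAction G hG hZ 1 ⊤ (isGraphic_conjAutOf_of_lifts G hG 1 hθ) hCT hDet
      (fun n => n.down.elim)

/-! ### Appended (abc-iut-w5-d226 gen 3, 11:3xZ): the same model also inhabits Prop 1.3 (iii) -/

/-- **[AbsTopII] Prop 1.3 (iii) (first clauses, F-0275), (vi) (F-0279) and (vii) (F-0280) hold
UNCONDITIONALLY at a constructed DPSC-extension** — non-vacuity of `prop13iii_ofOuterAction_of_fixing_lifts`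
(with its I-surj input DISCHARGED through Π_v-fixing lifts), `prop13vi_ofOuterAction_of_lifts` and
`prop13vii_ofOuterAction` at ONE kernel model: a pro-`Σ` completion `Π` of the genus-`2` surface group, the
one-vertex PSC datum of smooth proper shape on it, the trivial outer action `θ = 1` of `J := Π`, inertia
`I := J` (every class has the identity as a graphic, `Π_v`-fixing lift).
[cite: MochizukiAbsTopII2013, Prop 1.3 (iii) p.11] [cite: MochizukiCombGC2007, Prop 1.2 p.8] -/
theorem exists_ofOuterAction_prop13iii_vi_vii (Sigma : Set ℕ) (hS₁ : Sigma.Nonempty)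
    (hS₂ : ∀ p ∈ Sigma, p.Prime) :
    ∃ (Q : ProfiniteGrp.{0}) (ι₀ : PuncturedSurfaceGroup 2 0 →* Q) (_ : IsProSigmaCompletion Sigma ι₀)
      (G : PSCDatum Q) (hG : IsTopologicallyFinitelyGenerated Q),
      Subgroup.center (Q : Type) = ⊥ ∧ (∀ v, G.vertGp v = ⊤) ∧ IsEmpty G.graph.N ∧ IsEmpty G.graph.C ∧
      Nonempty G.graph.V ∧
      (ofOuterAction G hG (1 : Q →ₜ* outProfinite hG) ⊤).Prop13iii ∧
      (ofOuterAction G hG (1 : Q →ₜ* outProfinite hG) ⊤).Prop13vi ∧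
      (ofOuterAction G hG (1 : Q →ₜ* outProfinite hG) ⊤).Prop13vii := by
  -- the group: a pro-`Σ` completion of the genus-2 surface group
  obtain ⟨Q, ι₀, hι₀⟩ := IsProSigmaCompletion.exists_isProSigmaCompletion (PuncturedSurfaceGroup 2 0) Sigma
  have hG : IsTopologicallyFinitelyGenerated Q :=
    IsProSigmaCompletion.isTopologicallyFinitelyGenerated_of_puncturedSurfaceGroup (MulEquiv.refl _) hι₀
  have hslim : IsSlimGroup Q :=
    proSigmaSurfaceGroupSlim_holds Sigma hS₁ hS₂ 2 0 (by change 2 < 2 * 2 + 0; norm_num) Q ι₀ hι₀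
  have hZ : Subgroup.center (Q : Type) = ⊥ := center_eq_bot_of_isSlimGroup' hslim
  -- the one-vertex PSC datum of smooth proper shape
  let graph : PSCSemiGraph :=
    { V := Unit, N := Empty, C := Empty, nodeEnds := fun e => e.elim, cuspEnd := fun c => c.elim }
  let G : PSCDatum Q :=
    { Sigma := Sigma
      sigma_prime := hS₂
      sigma_nonempty := hS₁
      graph := graph
      vertGp := fun _ => ⊤
      nodeGp := fun e => e.elim
      cuspGp := fun c => c.elim
      genus := fun _ => 2
      isClosed_vertGp := fun _ => by simp
      isClosed_nodeGp := fun e => e.elim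
      isClosed_cuspGp := fun c => c.elim
      nodeGp_le := fun e => e.elim
      cuspGp_le := fun c => c.elim
      proSigma := isProSigma_of_isProSigmaCompletion hι₀ }
  -- [CombGC] Prop 1.2 (ii): the only verticial subgroup is `⊤`, there are no edge-like subgroups
  have hCT : G.VerticialEdgeLikeCommensurablyTerminal := by
    rintro A (⟨v, γ, rfl⟩ | (⟨e, -, -⟩ | ⟨c, -, -⟩))
    · change Subgroup.Commensurable.commensurator (γ • (⊤ : Subgroup Q)) = γ • ⊤
      rw [PSCDatum.conjAct_smul_top, commensurator_top]
    · exact e.elim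
    · exact c.elim
  -- [CombGC] Prop 1.2 (i): one vertex, no edges
  have hDetV : G.VerticialOpenInterDeterminesVertex := fun v₁ v₂ _ _ _ => Subsingleton.elim v₁ v₂
  have hDet : G.EdgeLikeOpenInterDeterminesEdge := by
    rintro (e | c)
    · exact e.elim
    · exact c.elim
  -- the trivial outer action: the identity lifts every class, is graphic and fixes everything
  have hid : ∀ j : (Q : Type),
      TopOut.mk (Q : Type) ⟨(ContinuousMulEquiv.refl (Q : Type)).toMulEquiv,
        (mem_contMulAut (Q : Type)).mpr ⟨(ContinuousMulEquiv.refl (Q : Type)).continuous,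
          (ContinuousMulEquiv.refl (Q : Type)).symm.continuous⟩⟩ =
        outerActionOfContinuous hG (1 : Q →ₜ* outProfinite hG) j := by
    intro j
    have h1 : outerActionOfContinuous hG (1 : Q →ₜ* outProfinite hG) j = 1 := by
      change (outEquiv hG).symm.toMonoidHom ((1 : Q →ₜ* outProfinite hG) j) = 1
      have h0 : ((1 : Q →ₜ* outProfinite hG) j) = 1 := rfl
      rw [h0, map_one]
    have h2 : ∀ hc : (ContinuousMulEquiv.refl (Q : Type)).toMulEquiv ∈ contMulAut (Q : Type),
        (⟨(ContinuousMulEquiv.refl (Q : Type)).toMulEquiv, hc⟩ : contMulAut (Q : Type)) = 1 :=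
      fun _ => Subtype.ext rfl
    rw [h1, h2, map_one]
  have hθ : ∀ j : (Q : Type), ∃ φ : (Q : Type) ≃ₜ* (Q : Type),
      TopOut.mk (Q : Type) ⟨φ.toMulEquiv, (mem_contMulAut (Q : Type)).mpr ⟨φ.continuous, φ.symm.continuous⟩⟩ =
        outerActionOfContinuous hG (1 : Q →ₜ* outProfinite hG) j ∧ G.IsGraphic G φ :=
    fun j => ⟨ContinuousMulEquiv.refl _, hid j, PSCDatum.isGraphic_refl G⟩
  have hfix : ∀ (w : G.graph.V) (i : (Q : Type)), i ∈ (⊤ : Subgroup (Q : Type)) →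
      ∃ φ : (Q : Type) ≃ₜ* (Q : Type),
        TopOut.mk (Q : Type) ⟨φ.toMulEquiv, (mem_contMulAut (Q : Type)).mpr ⟨φ.continuous, φ.symm.continuous⟩⟩ =
            outerActionOfContinuous hG (1 : Q →ₜ* outProfinite hG) i ∧
          ∀ x ∈ G.vertGp w, φ x = x :=
    fun _ i _ => ⟨ContinuousMulEquiv.refl _, hid i, fun _ _ => rfl⟩
  refine ⟨Q, ι₀, hι₀, G, hG, hZ, fun _ => rfl, inferInstanceAs (IsEmpty Empty),
    inferInstanceAs (IsEmpty Empty), ⟨()⟩, ?_, ?_, ?_⟩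
  · exact prop13iii_ofOuterAction_of_fixing_lifts G hG hZ 1 ⊤ hCT (fun _ => isSlimGroup_top hslim) hfix
  · exact prop13vi_ofOuterAction_of_lifts G hG hZ 1 ⊤ hθ hCT hDetV
  · exact prop13vii_ofOuterAction G hG hZ 1 ⊤ (isGraphic_conjAutOf_of_lifts G hG 1 hθ) hCT hDet
      (fun n => n.down.elim)

end DPSCData

end Literature.AnabelianGeometry.AbsoluteAnabelian

end
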